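import Summits.BirchSwinnertonDyer.BirchSwinnertonDyer.Theses.PlecticLegs
import Summits.BirchSwinnertonDyer.BirchSwinnertonDyer.Theorems.PlecticLegsArtinBaseChangeLSeries
import Literature.NumberTheory.EllipticCurves.AnalyticRankOverNumberField

/-!
# `ArtinBaseChange` (route `PlecticLegs`, stmt-BirchSwinnertonDyer-18261): Artin formalism for
# the analytic rank of `E/ℚ` over an abelian field `F = ℚ(ζ_m)^H`

The support item asserts: for `E/ℚ` elliptic, `m ≥ 1`, `H ≤ Gal(ℚ(ζ_m)/ℚ)` with fixed field `F`,
if every non-trivial Dirichlet character `χ` mod `m` trivial on `H` has an entire continuation of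
`∑ χ(n) aₙ(E) n⁻ˢ` non-vanishing at `s = 1`, then `r_an(E_F) = r_an(E)`.

## What is proved, and what is cited

* PROVED (this file and its `PlecticLegsArtinBaseChange*` siblings): Artin formalism for Mathlib's
  Hasse–Weil `L`-series at the primes `p ∤ m` — `L_w(E_F, T) = N_f L_p(E, T)` at the
  `[F:ℚ]/f` places `w ∣ p`, `f = ord(σ_p H)` (Tate modules, `…Local`; decomposition of `p` in
  `F`, `…Places`), the character product lemma (`…Characters`), the Euler-product bookkeeping
  (`…EulerLemmas`, `…EulerLocal`, `…Euler`) and the Dirichlet-series identity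
  `L(E_F, s) P(s) = L(E, s) Q(s) ∏_{χ ≠ 1} L(E, χ, s)` on `Re s > 3/2` with Dirichlet polynomials
  `P, Q` (the Euler factors above `m`), entire and non-zero at `1` (`…LSeries`); and the analytic
  assembly (identity theorem, additivity of orders of vanishing).
* CITED (named facts, hypotheses of `artinBaseChange_of`): the entire continuation of `L(E, s)`
  (`WeierstrassCurve.hasEntireLFunction_rat`: modularity, BCDT 2001) and of `L(E_F, s)` for
  abelian `F` (`hasEntireLFunction_baseChange_fixedField`, below: modularity + Artin formalism +
  twists of newforms); the second contains the first (`hasEntireLFunction_rat_of`, `m = 1`), so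
  `artinBaseChange_of_hasEntireLFunction_baseChange_fixedField` is `ArtinBaseChange` modulo ONE
  named fact. Without it `analyticRank` is a junk value on both sides (the order at `1` of
  `entireLFunction`, which is the `L`-series itself when no continuation exists), so the item
  cannot be closed unconditionally in the present tree; this file lands the reduction.
-/

noncomputable section

-- D-0017: single-problem summit, so `Summit.BirchSwinnertonDyer.BirchSwinnertonDyer.…` repeats a
-- namespace BY DESIGN.
set_option linter.dupNamespace false

open scoped Classical
open Complex Filter Topology NumberField

namespace Summit.BirchSwinnertonDyer.BirchSwinnertonDyer.Theorems

/-! ## Complex analysis: orders of vanishing from a factorisation -/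

/-- If entire functions satisfy `f · P = g · Q · ∏ᵢ Lᵢ` on the half-plane `Re z > 2`, with
`P, Q, Lᵢ` entire and non-vanishing at `1`, then `f` and `g` vanish to the same order at `1`
(identity theorem, additivity of the order of vanishing). [folklore] -/
theorem analyticOrderAt_eq_of_mul_eq_mul_prod {ι : Type*} (s : Finset ι) {f g P Q : ℂ → ℂ}
    {L : ι → ℂ → ℂ} (hf : Differentiable ℂ f) (hg : Differentiable ℂ g)
    (hP : Differentiable ℂ P) (hQ : Differentiable ℂ Q) (hL : ∀ i ∈ s, Differentiable ℂ (L i))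
    (hP1 : P 1 ≠ 0) (hQ1 : Q 1 ≠ 0) (hL1 : ∀ i ∈ s, L i 1 ≠ 0)
    (heq : ∀ z : ℂ, 2 < z.re → f z * P z = g z * Q z * ∏ i ∈ s, L i z) :
    analyticOrderAt f 1 = analyticOrderAt g 1 := by
  -- both sides are entire; they agree on an open set, hence everywhere
  have hL' : Differentiable ℂ (fun z ↦ ∏ i ∈ s, L i z) :=
    Differentiable.fun_finsetProd fun i hi ↦ hL i hi
  have hlhs : Differentiable ℂ (fun z ↦ f z * P z) := hf.mul hP
  have hrhs : Differentiable ℂ (fun z ↦ g z * Q z * ∏ i ∈ s, L i z) := (hg.mul hQ).mul hL'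
  have hopen : IsOpen {z : ℂ | (2 : ℝ) < z.re} := isOpen_lt continuous_const Complex.continuous_re
  have h3 : (3 : ℂ) ∈ {z : ℂ | (2 : ℝ) < z.re} := by
    show (2 : ℝ) < (3 : ℂ).re
    norm_num
  have hev : (fun z ↦ f z * P z) =ᶠ[𝓝 (3 : ℂ)] fun z ↦ g z * Q z * ∏ i ∈ s, L i z := by
    filter_upwards [hopen.mem_nhds h3] with z hz
    exact heq z hz
  have hall : (fun z ↦ f z * P z) = fun z ↦ g z * Q z * ∏ i ∈ s, L i z :=
    AnalyticOnNhd.eq_of_eventuallyEq (hlhs.differentiableOn.analyticOnNhd isOpen_univ)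
      (hrhs.differentiableOn.analyticOnNhd isOpen_univ) hev
  -- orders at 1
  have hfa : AnalyticAt ℂ f 1 := hf.analyticAt 1
  have hga : AnalyticAt ℂ g 1 := hg.analyticAt 1
  have hPa : AnalyticAt ℂ P 1 := hP.analyticAt 1
  have hQa : AnalyticAt ℂ Q 1 := hQ.analyticAt 1
  have hLa : AnalyticAt ℂ (fun z ↦ ∏ i ∈ s, L i z) 1 := hL'.analyticAt 1
  have hP0 : analyticOrderAt P 1 = 0 := hPa.analyticOrderAt_eq_zero.mpr hP1
  have hQ0 : analyticOrderAt Q 1 = 0 := hQa.analyticOrderAt_eq_zero.mpr hQ1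
  have hL0 : analyticOrderAt (fun z ↦ ∏ i ∈ s, L i z) 1 = 0 :=
    hLa.analyticOrderAt_eq_zero.mpr (Finset.prod_ne_zero_iff.mpr fun i hi ↦ hL1 i hi)
  have h1 : analyticOrderAt (fun z ↦ f z * P z) 1 = analyticOrderAt f 1 := by
    rw [show (fun z ↦ f z * P z) = f * P from rfl, analyticOrderAt_mul hfa hPa, hP0, add_zero]
  have h2 : analyticOrderAt (fun z ↦ g z * Q z * ∏ i ∈ s, L i z) 1 = analyticOrderAt g 1 := by
    rw [show (fun z ↦ g z * Q z * ∏ i ∈ s, L i z) = g * Q * fun z ↦ ∏ i ∈ s, L i z from rfl,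
      analyticOrderAt_mul (hga.mul hQa) hLa, analyticOrderAt_mul hga hQa, hQ0, hL0, add_zero,
      add_zero]
  rw [← h1, hall, h2]

/-! ## The named fact: `L(E/F, s)` is entire for abelian `F` -/

set_option backward.isDefEq.respectTransparency false in
/-- **`hasEntireLFunction_baseChange_fixedField` contains `hasEntireLFunction_rat`** (take
`m = 1`, `H = ⊤`, `F = ℚ(ζ₁)^⊤ ≅ ℚ`): by the proved Artin formalism with no prime dividing `m` and
only the trivial character, `L(E_F) = L(E)` as formal Dirichlet series
(`intCoe_LFunction_baseChange_mul_eq_prod_twist` at `m = 1`), so an entire continuation of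
`L(E_F, s)` is one of `L(E, s)`. [folklore] -/
theorem hasEntireLFunction_rat_of (hX : Literature.NumberTheory.EllipticCurves.hasEntireLFunction_baseChange_fixedField) :
    WeierstrassCurve.hasEntireLFunction_rat := by
  intro W _
  haveI : IsCyclotomicExtension {1} ℚ (CyclotomicField 1 ℚ) :=
    CyclotomicField.isCyclotomicExtension 1 ℚ
  haveI : IsAbelianGalois ℚ (CyclotomicField 1 ℚ) :=
    IsCyclotomicExtension.isAbelianGalois {1} ℚ (CyclotomicField 1 ℚ)
  set H : Subgroup (CyclotomicField 1 ℚ ≃ₐ[ℚ] CyclotomicField 1 ℚ) := ⊤ with hH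
  set F := IntermediateField.fixedField H with hFdef
  have hWF : (W.baseChange ↥F).HasEntireLFunction := hX W 1 H
  -- the formal identity at `m = 1`: no prime divides `1`, and the only character is `1`
  have key := intCoe_LFunction_baseChange_mul_eq_prod_twist W 1 (CyclotomicField 1 ℚ) H
  have hS : (finite_setOf_natCast_mem 1).toFinset = ∅ := by
    rw [Finset.eq_empty_iff_forall_notMem]
    intro v hv
    rw [Set.Finite.mem_toFinset, Set.mem_setOf_eq, Nat.cast_one] at hv
    exact v.isPrime.ne_top ((Ideal.eq_top_iff_one _).mpr hv)
  have hY : Finset.univ.filter (fun χ : DirichletCharacter ℂ 1 ↦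
      χ ∈ (IsCyclotomicExtension.Rat.subgroupGalEquivSubgroupChar 1 (CyclotomicField 1 ℚ) ℂ H).ofDual) = {1} := by
    refine Finset.eq_singleton_iff_unique_mem.mpr ⟨?_, fun χ _ ↦ χ.level_one⟩
    rw [Finset.mem_filter]
    exact ⟨Finset.mem_univ _, one_mem _⟩
  have htw : (toArithmeticFunction (fun k : ℕ ↦ (1 : DirichletCharacter ℂ 1) (k : ZMod 1))).pmul
      ((W.LFunction : ArithmeticFunction ℤ) : ArithmeticFunction ℂ) =
      ((W.LFunction : ArithmeticFunction ℤ) : ArithmeticFunction ℂ) := by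
    ext n
    rw [twist_apply, MulChar.one_apply (isUnit_of_subsingleton _), one_mul]
  rw [hS, Finset.prod_empty, mul_one, hY, Finset.prod_singleton, htw] at key
  -- hence `L(E_F, s) = L(E, s)` and the continuation transfers
  refine ⟨(W.baseChange ↥F).entireLFunction, (W.baseChange ↥F).differentiable_entireLFunction hWF,
    fun s hs ↦ ?_⟩
  rw [(W.baseChange ↥F).entireLFunction_eq_LSeries hWF hs]
  change LSeries (⇑(((W.baseChange ↥F).LFunction : ArithmeticFunction ℤ) : ArithmeticFunction ℂ)) s =
    LSeries (⇑((W.LFunction : ArithmeticFunction ℤ) : ArithmeticFunction ℂ)) s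
  rw [key]

/-! ## Assembly -/

set_option backward.isDefEq.respectTransparency false in
/-- **Artin formalism for the analytic rank under abelian base change** (route `PlecticLegs`,
support item `ArtinBaseChange`, stmt-BirchSwinnertonDyer-18261), CONDITIONAL on the entire
continuation of `L(E/F, s)` for abelian `F` (`hasEntireLFunction_baseChange_fixedField`) and of
`L(E, s)` (`WeierstrassCurve.hasEntireLFunction_rat`, modularity). Given these, for `E/ℚ`
elliptic, `m ≥ 1`, `H ≤ Gal(ℚ(ζ_m)/ℚ)` with fixed field `F`: if every non-trivial Dirichlet
character mod `m` trivial on `H` has an entire continuation `L_χ` of `∑ χ(n) aₙ(E) n⁻ˢ` with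
`L_χ(1) ≠ 0`, then `r_an(E_F) = r_an(E)`. Proof: the PROVED Artin formalism
`L(E_F, s) P(s) = L(E, s) Q(s) ∏_{χ ≠ 1} L_χ(s)` (`exists_LSeries_baseChange_fixedField_identity`,
`Re s > 2`) extends to `ℂ` by the identity theorem, and orders of vanishing at `1` add up, the
factors `P, Q, L_χ` not vanishing there. -/
theorem artinBaseChange_of (hX : Literature.NumberTheory.EllipticCurves.hasEntireLFunction_baseChange_fixedField)
    (hE : WeierstrassCurve.hasEntireLFunction_rat) :
    Summit.BirchSwinnertonDyer.BirchSwinnertonDyer.Theses.PlecticLegs.ArtinBaseChange := by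
  intro W _ m _ H hχ
  haveI : IsCyclotomicExtension {m} ℚ (CyclotomicField m ℚ) :=
    CyclotomicField.isCyclotomicExtension m ℚ
  haveI : IsAbelianGalois ℚ (CyclotomicField m ℚ) :=
    IsCyclotomicExtension.isAbelianGalois {m} ℚ (CyclotomicField m ℚ)
  set F := IntermediateField.fixedField H with hFdef
  show (W.baseChange ↥F).analyticRank = W.analyticRank
  -- the Dirichlet-series identity (proved Artin formalism)
  obtain ⟨P, Q, hP, hQ, hP1, hQ1, hPQ⟩ :=
    exists_LSeries_baseChange_fixedField_identity W m (CyclotomicField m ℚ) H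
  -- entire continuations (cited)
  have hWF : (W.baseChange ↥F).HasEntireLFunction := hX W m H
  have hW : W.HasEntireLFunction := hE W
  set X := (Finset.univ.filter (fun χ : DirichletCharacter ℂ m ↦
    χ ∈ (IsCyclotomicExtension.Rat.subgroupGalEquivSubgroupChar m (CyclotomicField m ℚ) ℂ H).ofDual)).erase 1 with hXdef
  -- the twisted continuations, chosen from the hypothesis
  have hLex : ∀ χ ∈ X, ∃ L : ℂ → ℂ, Differentiable ℂ L ∧
      (∀ s : ℂ, 2 < s.re → L s = LSeries (fun n ↦ χ n * ((W.LFunction n : ℤ) : ℂ)) s) ∧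
      L 1 ≠ 0 := by
    intro χ hχX
    obtain ⟨hne, hmem⟩ := Finset.mem_erase.mp hχX
    have hmem' : χ ∈ (IsCyclotomicExtension.Rat.subgroupGalEquivSubgroupChar m (CyclotomicField m ℚ) ℂ H).ofDual :=
      (Finset.mem_filter.mp hmem).2
    exact hχ χ (fun σ hσ a ha ↦
      apply_eq_one_of_mem_subgroupChar m (CyclotomicField m ℚ) hmem' hσ ha) hne
  choose! L hLd hLeq hL1 using hLex
  refine congrArg ENat.toNat ?_
  refine analyticOrderAt_eq_of_mul_eq_mul_prod X
    ((W.baseChange ↥F).differentiable_entireLFunction hWF) (W.differentiable_entireLFunction hW)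
    hP hQ hLd hP1 hQ1 hL1 fun z hz ↦ ?_
  have hz' : (3 / 2 : ℝ) < z.re := by linarith
  rw [(W.baseChange ↥F).entireLFunction_eq_LSeries hWF hz', W.entireLFunction_eq_LSeries hW hz',
    hPQ z hz']
  refine congrArg _ (Finset.prod_congr rfl fun χ hχX ↦ ?_)
  exact (hLeq χ hχX z hz).symm

/-- **`ArtinBaseChange` modulo the single named fact `hasEntireLFunction_baseChange_fixedField`**
(the entire continuation of `L(E/F, s)` for abelian `F ⊂ ℚ(ζ_m)`, which at `m = 1` is that of
`L(E, s)`): `artinBaseChange_of` with `hasEntireLFunction_rat_of`. -/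
theorem artinBaseChange_of_hasEntireLFunction_baseChange_fixedField
    (hX : Literature.NumberTheory.EllipticCurves.hasEntireLFunction_baseChange_fixedField) :
    Summit.BirchSwinnertonDyer.BirchSwinnertonDyer.Theses.PlecticLegs.ArtinBaseChange :=
  artinBaseChange_of hX (hasEntireLFunction_rat_of hX)

end Summit.BirchSwinnertonDyer.BirchSwinnertonDyer.Theorems

end
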